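import Mathlib
import Literature.Computability.Complexity.ProductWeights

/-!
# Venture YMGap, track Y3 FLOW-DATA — the POINTWISE inequality behind lineage A's one-build relative bracket «BRACKET-1» (ENGINE.md §9.2, PROOF 2), typed

HONEST FRAMING: venture file of the cell `pub-ymgap` (QuantumFields programme), track Y3, lineage A (seat flow-eng-1).  Pure finite
algebra over `ℝ`; NO lattice statement, no number of record, nothing about limits or a mass gap.

BRACKET-1 (engine «sntm» v2.3, task `"tail2": {"mode": "bracket1"}`) builds ONE Galerkin matrix `G(1)` of the product weight
`Π_p W_p(w₀)`, `W_p(w₀) = w₀ − 1 + a_p` (`a_p = w_p^{(J_c)}` the kept characters), at `w₀ = 1`, and brackets the true weight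
`Π_p w_p` (`|w_p − a_p| ≤ τ`, `w_p ≥ w_min`) RELATIVELY: with `c = N/(w_min − 2τ)` and `cτ < 1`,
`(1 − cτ) G(1) ⪯ G(1 − τ) ⪯ G_S ⪯ G(1 + τ) ⪯ (1 − cτ)⁻¹ G(1)`.  The tree file `RelativeBracketCertificate` (p375865) takes the four
Loewner inequalities as hypotheses; `GalerkinWeightMonotone.posSemidef_weightMatrix_sub` (p378639) reduces them to POINTWISE
inequalities between the weights; this file proves those pointwise inequalities (ENGINE.md §9.2 «PROOF 2, the one to type»,
in the Weierstrass-product form, no calculus):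

* Weierstrass `1 − Σ δ_p ≤ Π (1 − δ_p)` is the tree's `Literature.Computability.Complexity.ProductWeights.one_sub_sum_le_prod_one_sub`;
* ★ `prod_shift_ge_one_sub_mul_prod` — for `m > 0`, `u ≤ v` and `W_p(u) = u − 1 + a_p ≥ m` on `s`:
  `(1 − #s·(v−u)/m) · Π_p (v − 1 + a_p) ≤ Π_p (u − 1 + a_p) ≤ Π_p (v − 1 + a_p)`;
* `bracket1_pointwise_upper` / `bracket1_pointwise_lower` — the two instances `(u,v) = (1, 1+τ)` and `(1−τ, 1)`:
  `(1 − cτ)·Π(a_p + τ) ≤ Π a_p` and `(1 − cτ)·Π a_p ≤ Π(a_p − τ)` with `cτ = #s·τ/(w_min − 2τ)`, under `a_p ≥ w_min − τ`;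
* ★ `bracket1_pointwise_chain` — with `|w_p − a_p| ≤ τ` and `w_p ≥ w_min > 2τ` on `s`: the full pointwise chain
  `(1 − cτ) Π a ≤ Π (a − τ) ≤ Π w ≤ Π (a + τ)` and `(1 − cτ) Π (a + τ) ≤ Π a`.

References: the cell's HOME/pub-ymgap-flow-eng-1/ENGINE.md §9.2 (2026-08-24); the Weierstrass product inequality [folklore];
R. A. Horn, C. R. Johnson, *Matrix Analysis* (2013) §7.7 for the Loewner-order use downstream [cite: HornJohnson2013, §7.7].
-/

noncomputable section

open Finset
open scoped BigOperators

namespace Summit.Ventures.YMGap.FlowData.Bracket1Pointwise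

variable {ι : Type*}

/-- ★ **The pointwise relative bracket** (ENGINE.md §9.2, PROOF 2 in Weierstrass form): for `m > 0`, `u ≤ v` and
`W_p(u) = u − 1 + a_p ≥ m` on `s`:  `(1 − #s·(v−u)/m)·Π_p (v − 1 + a_p) ≤ Π_p (u − 1 + a_p) ≤ Π_p (v − 1 + a_p)`
(write `W_p(u) = W_p(v)(1 − δ_p)`, `δ_p = (v−u)/W_p(v) ∈ [0, 1)`, `Σ δ_p ≤ #s (v−u)/m`, and use Weierstrass). [folklore] -/
theorem prod_shift_ge_one_sub_mul_prod (s : Finset ι) (a : ι → ℝ) {m u v : ℝ} (hm : 0 < m) (huv : u ≤ v)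
    (hW : ∀ p ∈ s, m ≤ u - 1 + a p) :
    (1 - s.card * (v - u) / m) * ∏ p ∈ s, (v - 1 + a p) ≤ ∏ p ∈ s, (u - 1 + a p)
      ∧ ∏ p ∈ s, (u - 1 + a p) ≤ ∏ p ∈ s, (v - 1 + a p) := by
  have hWv : ∀ p ∈ s, m ≤ v - 1 + a p := fun p hp => (hW p hp).trans (by linarith)
  have hWu0 : ∀ p ∈ s, 0 ≤ u - 1 + a p := fun p hp => hm.le.trans (hW p hp)
  have hWv0 : ∀ p ∈ s, 0 < v - 1 + a p := fun p hp => hm.trans_le (hWv p hp)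
  refine ⟨?_, prod_le_prod hWu0 fun p hp => by linarith⟩
  -- Π W(u) = Π W(v) · Π (1 − δ_p),  δ_p = (v − u)/W_p(v) ∈ [0, (v−u)/m] ⊆ [0, 1]
  set δ : ι → ℝ := fun p => (v - u) / (v - 1 + a p) with hδ
  have hfac : ∀ p ∈ s, u - 1 + a p = (v - 1 + a p) * (1 - δ p) := by
    intro p hp
    have hne : v - 1 + a p ≠ 0 := (hWv0 p hp).ne'
    simp only [hδ]
    field_simp
    ring
  rw [prod_congr rfl hfac, prod_mul_distrib]
  have hδ0 : ∀ p ∈ s, 0 ≤ δ p := fun p hp => div_nonneg (sub_nonneg.2 huv) (hWv0 p hp).le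
  have hδm : ∀ p ∈ s, δ p ≤ (v - u) / m := fun p hp =>
    div_le_div_of_nonneg_left (sub_nonneg.2 huv) hm (hWv p hp)
  have hδ1 : ∀ p ∈ s, δ p ≤ 1 := fun p hp =>
    (div_le_one (hWv0 p hp)).2 (by linarith [hW p hp, hm.le])
  have hwei := Literature.Computability.Complexity.ProductWeights.one_sub_sum_le_prod_one_sub s δ hδ0 hδ1
  have hsum : ∑ p ∈ s, δ p ≤ s.card * (v - u) / m := by
    calc ∑ p ∈ s, δ p ≤ ∑ p ∈ s, (v - u) / m := sum_le_sum hδm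
      _ = s.card * (v - u) / m := by rw [sum_const, nsmul_eq_mul]; ring
  have hPv : 0 ≤ ∏ p ∈ s, (v - 1 + a p) := prod_nonneg fun p hp => (hWv0 p hp).le
  calc (1 - s.card * (v - u) / m) * ∏ p ∈ s, (v - 1 + a p)
        ≤ (∏ p ∈ s, (1 - δ p)) * ∏ p ∈ s, (v - 1 + a p) :=
          mul_le_mul_of_nonneg_right (by linarith) hPv
    _ = (∏ p ∈ s, (v - 1 + a p)) * ∏ p ∈ s, (1 - δ p) := mul_comm _ _

/-- BRACKET-1, upper instance `(u, v) = (1, 1 + τ)`: `(1 − #s·τ/(w_min − 2τ))·Π_p (a_p + τ) ≤ Π_p a_p` when `a_p ≥ w_min − τ`,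
`0 ≤ τ`, `w_min > 2τ` (so `G(1+τ) ⪯ (1 − cτ)⁻¹ G(1)` after compression). [folklore] -/
theorem bracket1_pointwise_upper (s : Finset ι) (a : ι → ℝ) {wmin τ : ℝ} (hτ : 0 ≤ τ) (hw : 2 * τ < wmin)
    (ha : ∀ p ∈ s, wmin - τ ≤ a p) :
    (1 - s.card * τ / (wmin - 2 * τ)) * ∏ p ∈ s, (a p + τ) ≤ ∏ p ∈ s, a p := by
  have h' := (prod_shift_ge_one_sub_mul_prod s a (m := wmin - 2 * τ) (u := 1) (v := 1 + τ) (by linarith) (by linarith)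
    (fun p hp => by linarith [ha p hp])).1
  have e1 : ∏ p ∈ s, (1 + τ - 1 + a p) = ∏ p ∈ s, (a p + τ) := prod_congr rfl fun p _ => by ring
  have e2 : ∏ p ∈ s, (1 - 1 + a p) = ∏ p ∈ s, a p := prod_congr rfl fun p _ => by ring
  have e3 : (1 : ℝ) + τ - 1 = τ := by ring
  rw [e1, e2, e3] at h'
  exact h'

/-- BRACKET-1, lower instance `(u, v) = (1 − τ, 1)`: `(1 − #s·τ/(w_min − 2τ))·Π_p a_p ≤ Π_p (a_p − τ)` when `a_p ≥ w_min − τ`,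
`0 ≤ τ`, `w_min > 2τ` (so `(1 − cτ) G(1) ⪯ G(1−τ)` after compression). [folklore] -/
theorem bracket1_pointwise_lower (s : Finset ι) (a : ι → ℝ) {wmin τ : ℝ} (hτ : 0 ≤ τ) (hw : 2 * τ < wmin)
    (ha : ∀ p ∈ s, wmin - τ ≤ a p) :
    (1 - s.card * τ / (wmin - 2 * τ)) * ∏ p ∈ s, a p ≤ ∏ p ∈ s, (a p - τ) := by
  have h' := (prod_shift_ge_one_sub_mul_prod s a (m := wmin - 2 * τ) (u := 1 - τ) (v := 1) (by linarith) (by linarith)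
    (fun p hp => by linarith [ha p hp])).1
  have e1 : ∏ p ∈ s, (1 - 1 + a p) = ∏ p ∈ s, a p := prod_congr rfl fun p _ => by ring
  have e2 : ∏ p ∈ s, (1 - τ - 1 + a p) = ∏ p ∈ s, (a p - τ) := prod_congr rfl fun p _ => by ring
  have e3 : (1 : ℝ) - (1 - τ) = τ := by ring
  rw [e1, e2, e3] at h'
  exact h'

/-- ★ **The full pointwise chain of BRACKET-1** (ENGINE.md §9.2): if on the plaquette family `s` the kept weights satisfy
`|w_p − a_p| ≤ τ` and the true weights `w_p ≥ w_min` with `w_min > 2τ ≥ 0`, then with `x = #s·τ/(w_min − 2τ)`: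
`(1 − x)·Π a ≤ Π (a − τ)`, `Π (a − τ) ≤ Π w`, `Π w ≤ Π (a + τ)` and `(1 − x)·Π (a + τ) ≤ Π a`.
With `GalerkinWeightMonotone.posSemidef_weightMatrix_sub` these are exactly the four Loewner hypotheses of
`RelativeBracket.eigenvalues₀_bracket1` / `bracket1_block_enclosure` (`G₁ = G(1)`, `Gm = G(1−τ)`, `Gp = G(1+τ)`). [folklore] -/
theorem bracket1_pointwise_chain (s : Finset ι) (a w : ι → ℝ) {wmin τ : ℝ} (hτ : 0 ≤ τ) (hw2 : 2 * τ < wmin)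
    (hclose : ∀ p ∈ s, |w p - a p| ≤ τ) (hwmin : ∀ p ∈ s, wmin ≤ w p) :
    (1 - s.card * τ / (wmin - 2 * τ)) * ∏ p ∈ s, a p ≤ ∏ p ∈ s, (a p - τ)
      ∧ ∏ p ∈ s, (a p - τ) ≤ ∏ p ∈ s, w p
      ∧ ∏ p ∈ s, w p ≤ ∏ p ∈ s, (a p + τ)
      ∧ (1 - s.card * τ / (wmin - 2 * τ)) * ∏ p ∈ s, (a p + τ) ≤ ∏ p ∈ s, a p := by
  have ha : ∀ p ∈ s, wmin - τ ≤ a p := fun p hp => by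
    have := (abs_sub_le_iff.1 (hclose p hp)).1
    linarith [hwmin p hp]
  refine ⟨bracket1_pointwise_lower s a hτ hw2 ha, ?_, ?_, bracket1_pointwise_upper s a hτ hw2 ha⟩
  · exact prod_le_prod (fun p hp => by linarith [ha p hp]) fun p hp => by
      have := (abs_sub_le_iff.1 (hclose p hp)).2
      linarith
  · exact prod_le_prod (fun p hp => by linarith [hwmin p hp, ha p hp]) fun p hp => by
      have := (abs_sub_le_iff.1 (hclose p hp)).1
      linarith

end Summit.Ventures.YMGap.FlowData.Bracket1Pointwise

end
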